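import Summits.AtomisticToContinuum.FouriersLaw.Theorems.OddSectorIrreversibilityResponseDensityGibbsPairing
import Literature.MathematicalPhysics.KineticTheory.LangevinChainNoiseContinuity

/-!
# Continuity of the transition kernels of the pinned chain in the bath temperatures

Helper file for item stmt-AtomisticToContinuum-9144 (`ResponseDensity`, route
`OddSectorIrreversibility`, sub-problem `FouriersLaw` of `AtomisticToContinuum`).

The hypothesis `hCONT` of the conditional reduction (`…ResponseDensityAssembly.lean`) PROVED: for every
continuous observable `φ` with `|φ| ≤ C e^{ϑH}` (`0 < ϑ`, `2ϑ < 1/T`), every `s ≥ 0` and `x`, the forecast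
`δ ↦ P^{(T+δ/2, T-δ/2)}_s φ(x)` is continuous at `δ = 0`
(`pinnedChain_tendsto_integral_kernel_temps`). Pathwise, the solution map depends on the temperatures
only through the noise amplitudes `√(2γT_b)`, which scale the (regularised) Brownian paths linearly,
and the flow is continuous in the noise path (`pinnedChain_exists_norm_chainFlow_sub_lt`); the passage
to expectations is a `3ε`-argument: bounded truncations `χ(H/K)φ` converge by dominated convergence and
the truncation error is `O(e^{-ϑK})` uniformly in `δ` by the exponential moment bound (3.4).
No definitions.
-/

noncomputable section

open MeasureTheory ProbabilityTheory Filter Topology Set Metric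
open scoped NNReal ENNReal

namespace Summit.AtomisticToContinuum.FouriersLaw.Theorems

open Literature.MathematicalPhysics.KineticTheory.HeatConduction
open Literature.Probability.Process Literature.MathematicalPhysics.KineticTheory OscillatorChain

variable {N : ℕ}

/-! ### The noise path is affine in the amplitudes -/

/-- Component formula for the difference of two noise paths with the same raw paths. -/
theorem chainNoise_sub_apply (N : ℕ) (a b a' b' : ℝ) (w : WienerPair) (r : ℝ) (i : Fin N) :
    chainNoise N a b w r i - chainNoise N a' b' w r i =
      (if i.val = 0 then a - a' else 0) * (pathRegularize w.1 r.toNNReal - pathRegularize w.1 0) +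
        (if i.val = N - 1 then b - b' else 0) * (pathRegularize w.2 r.toNNReal - pathRegularize w.2 0) := by
  simp only [chainNoise]
  split_ifs <;> ring

/-- `‖η_{a,b}(r) - η_{a',b'}(r)‖ ≤ |a - a'| |w̄₁(r⁺) - w̄₁(0)| + |b - b'| |w̄₂(r⁺) - w̄₂(0)|`. -/
theorem norm_chainNoise_sub_le (N : ℕ) (a b a' b' : ℝ) (w : WienerPair) (r : ℝ) :
    ‖chainNoise N a b w r - chainNoise N a' b' w r‖ ≤
      |a - a'| * |pathRegularize w.1 r.toNNReal - pathRegularize w.1 0| +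
        |b - b'| * |pathRegularize w.2 r.toNNReal - pathRegularize w.2 0| := by
  refine (pi_norm_le_iff_of_nonneg (by positivity)).2 fun i => ?_
  rw [Pi.sub_apply, Real.norm_eq_abs, chainNoise_sub_apply]
  have hA := abs_nonneg (pathRegularize w.1 r.toNNReal - pathRegularize w.1 0)
  have hB := abs_nonneg (pathRegularize w.2 r.toNNReal - pathRegularize w.2 0)
  refine (abs_add_le _ _).trans (add_le_add ?_ ?_)
  · rw [abs_mul]
    refine mul_le_mul_of_nonneg_right ?_ hA
    split_ifs
    · exact le_rfl
    · rw [abs_zero]; exact abs_nonneg _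
  · rw [abs_mul]
    refine mul_le_mul_of_nonneg_right ?_ hB
    split_ifs
    · exact le_rfl
    · rw [abs_zero]; exact abs_nonneg _

/-- `‖η_{a,b}(r)‖ ≤ |a| |w̄₁(r⁺) - w̄₁(0)| + |b| |w̄₂(r⁺) - w̄₂(0)|`. -/
theorem norm_chainNoise_le (N : ℕ) (a b : ℝ) (w : WienerPair) (r : ℝ) :
    ‖chainNoise N a b w r‖ ≤
      |a| * |pathRegularize w.1 r.toNNReal - pathRegularize w.1 0| +
        |b| * |pathRegularize w.2 r.toNNReal - pathRegularize w.2 0| := by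
  have h := norm_chainNoise_sub_le N a b 0 0 w r
  have h0 : chainNoise N 0 0 w r = 0 := by
    funext i; simp [chainNoise]
  rwa [h0, sub_zero, sub_zero, sub_zero] at h

/-! ### Pathwise continuity of the solution map in the bath temperatures -/

section Pathwise

variable {ω₂ lam β γ : ℝ} (hω : 0 < ω₂) (hl : 0 ≤ lam) (hβ : 0 ≤ β) (hγ : 0 ≤ γ) (N : ℕ)
  {T : ℝ} (hT : 0 < T)
include hω hl hβ hγ hT

/-- **The solution map is continuous in the bath temperatures along the anti-diagonal**, pathwise:
`δ ↦ Φ^{(T+δ/2, T-δ/2)}_s(x, w) → Φ^{(T,T)}_s(x, w)` as `δ → 0`, for every raw path pair `w`. -/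
theorem pinnedChain_tendsto_solMap_temps (s : ℝ) (x : PhaseSpace N) (w : WienerPair) :
    Tendsto (fun δ : ℝ => (pinnedChain ω₂ lam β γ).solMap N (T + δ / 2) (T - δ / 2) s x w) (𝓝 0)
      (𝓝 ((pinnedChain ω₂ lam β γ).solMap N T T s x w)) := by
  rcases le_or_gt s 0 with hs | hs
  · have h1 : ∀ δ : ℝ, (pinnedChain ω₂ lam β γ).solMap N (T + δ / 2) (T - δ / 2) s x w = x :=
      fun δ => pinnedChain_solMap_of_nonpos N _ _ x w hs
    rw [pinnedChain_solMap_of_nonpos N T T x w hs]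
    simp_rw [h1]
    exact tendsto_const_nhds
  -- bounds of the two regularised paths on `[0, s]`
  set A : ℝ → ℝ := fun r => pathRegularize w.1 r.toNNReal - pathRegularize w.1 0 with hA
  set B : ℝ → ℝ := fun r => pathRegularize w.2 r.toNNReal - pathRegularize w.2 0 with hB
  have hAc : Continuous A := (continuous_pathRegularize_toNNReal w.1).sub continuous_const
  have hBc : Continuous B := (continuous_pathRegularize_toNNReal w.2).sub continuous_const
  obtain ⟨Ab, hAb⟩ := isCompact_Icc.exists_bound_of_continuousOn (hAc.continuousOn (s := Icc 0 s))
  obtain ⟨Bb, hBb⟩ := isCompact_Icc.exists_bound_of_continuousOn (hBc.continuousOn (s := Icc 0 s))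
  have hAb0 : 0 ≤ Ab := (norm_nonneg _).trans (hAb 0 ⟨le_rfl, hs.le⟩)
  have hBb0 : 0 ≤ Bb := (norm_nonneg _).trans (hBb 0 ⟨le_rfl, hs.le⟩)
  -- amplitudes and their continuity
  set cL : ℝ → ℝ := fun δ => Real.sqrt (2 * γ * (T + δ / 2)) with hcL
  set cR : ℝ → ℝ := fun δ => Real.sqrt (2 * γ * (T - δ / 2)) with hcR
  have hcLc : Continuous cL := Real.continuous_sqrt.comp (by fun_prop)
  have hcRc : Continuous cR := Real.continuous_sqrt.comp (by fun_prop)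
  -- a uniform bound of the amplitudes for `|δ| < T`
  set cmax : ℝ := Real.sqrt (2 * γ * (2 * T)) with hcmax
  have hcb : ∀ δ : ℝ, |δ| < T → |cL δ| ≤ cmax ∧ |cR δ| ≤ cmax := by
    intro δ hδ
    have h1 := abs_lt.1 hδ
    constructor
    · rw [abs_of_nonneg (Real.sqrt_nonneg _)]
      exact Real.sqrt_le_sqrt (by nlinarith)
    · rw [abs_of_nonneg (Real.sqrt_nonneg _)]
      exact Real.sqrt_le_sqrt (by nlinarith)
  set M : ℝ := cmax * Ab + cmax * Bb with hM
  -- the noise paths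
  have hη : ∀ δ : ℝ, (pinnedChain ω₂ lam β γ).solMap N (T + δ / 2) (T - δ / 2) s x w =
      (pinnedChain ω₂ lam β γ).chainFlow N x (chainNoise N (cL δ) (cR δ) w) s := fun δ => rfl
  have hη0 : (pinnedChain ω₂ lam β γ).solMap N T T s x w =
      (pinnedChain ω₂ lam β γ).chainFlow N x (chainNoise N (cL 0) (cR 0) w) s := by
    simp only [hcL, hcR, zero_div, add_zero, sub_zero]; rfl
  have hbdd : ∀ δ : ℝ, |δ| < T → ∀ r ∈ Icc 0 s, ‖chainNoise N (cL δ) (cR δ) w r‖ ≤ M := by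
    intro δ hδ r hr
    obtain ⟨h1, h2⟩ := hcb δ hδ
    have hAr : |A r| ≤ Ab := Real.norm_eq_abs _ ▸ hAb r hr
    have hBr : |B r| ≤ Bb := Real.norm_eq_abs _ ▸ hBb r hr
    calc _ ≤ |cL δ| * |A r| + |cR δ| * |B r| := norm_chainNoise_le N _ _ w r
      _ ≤ cmax * Ab + cmax * Bb := add_le_add (mul_le_mul h1 hAr (abs_nonneg _) (Real.sqrt_nonneg _))
          (mul_le_mul h2 hBr (abs_nonneg _) (Real.sqrt_nonneg _))
  -- `ε`-`δ`
  rw [Metric.tendsto_nhds]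
  intro ε hε
  obtain ⟨δ', hδ'0, hflow⟩ := pinnedChain_exists_norm_chainFlow_sub_lt hω hl hβ hγ N
    ((pinnedChain ω₂ lam β γ).hamiltonian N x) M s hε
  -- `|cL δ - cL 0| Ab + |cR δ - cR 0| Bb ≤ δ'` near `δ = 0`
  have hamp : ∀ᶠ δ in 𝓝 (0 : ℝ), |cL δ - cL 0| * Ab + |cR δ - cR 0| * Bb ≤ δ' := by
    have h : Tendsto (fun δ => |cL δ - cL 0| * Ab + |cR δ - cR 0| * Bb) (𝓝 0) (𝓝 0) := by
      have h1 : Tendsto (fun δ => |cL δ - cL 0| * Ab) (𝓝 0) (𝓝 (|cL 0 - cL 0| * Ab)) :=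
        ((hcLc.tendsto 0).sub tendsto_const_nhds).abs.mul_const _
      have h2 : Tendsto (fun δ => |cR δ - cR 0| * Bb) (𝓝 0) (𝓝 (|cR 0 - cR 0| * Bb)) :=
        ((hcRc.tendsto 0).sub tendsto_const_nhds).abs.mul_const _
      simpa using h1.add h2
    exact (h.eventually (Iic_mem_nhds hδ'0)).mono fun δ hδ => hδ
  have hball : ∀ᶠ δ in 𝓝 (0 : ℝ), |δ| < T := by
    have : Metric.ball (0 : ℝ) T ∈ 𝓝 (0 : ℝ) := Metric.ball_mem_nhds 0 hT
    filter_upwards [this] with δ hδ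
    simpa [Real.dist_eq] using hδ
  filter_upwards [hamp, hball] with δ hδ hδT
  rw [hη δ, hη0, dist_eq_norm]
  refine hflow x le_rfl _ _ (continuous_chainNoise _ _ w) (continuous_chainNoise _ _ w) (hbdd δ hδT)
    (hbdd 0 (by simpa using hT)) (fun r hr => ?_) s ⟨hs.le, le_rfl⟩
  have hAr : |A r| ≤ Ab := Real.norm_eq_abs _ ▸ hAb r hr
  have hBr : |B r| ≤ Bb := Real.norm_eq_abs _ ▸ hBb r hr
  calc _ ≤ |cL δ - cL 0| * |A r| + |cR δ - cR 0| * |B r| := norm_chainNoise_sub_le N _ _ _ _ w r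
    _ ≤ |cL δ - cL 0| * Ab + |cR δ - cR 0| * Bb :=
        add_le_add (mul_le_mul_of_nonneg_left hAr (abs_nonneg _)) (mul_le_mul_of_nonneg_left hBr (abs_nonneg _))
    _ ≤ δ' := hδ

end Pathwise

/-! ### Continuity of the forecasts in the bath temperatures -/

section Expectation

variable {ω₂ lam β γ : ℝ} (hω : 0 < ω₂) (hl : 0 ≤ lam) (hβ : 0 ≤ β) (hγ : 0 < γ) (hN : 0 < N)
  {T : ℝ} (hT : 0 < T) {ϑ : ℝ} (hϑ : 0 < ϑ) (h2ϑ : 2 * ϑ < 1 / T)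
  {φ : PhaseSpace N → ℝ} (hφc : Continuous φ) {C : ℝ}
  (hφ : ∀ y, |φ y| ≤ C * Real.exp (ϑ * (pinnedChain ω₂ lam β γ).hamiltonian N y))
include hω hl hβ hγ hN hT hϑ h2ϑ hφc hφ

omit hN hϑ h2ϑ hφ in
/-- **Forecasts of bounded truncations are continuous in the bath temperatures**:
`δ ↦ P^{(T+δ/2,T-δ/2)}_s (χ(H/K) φ)(x)` is continuous at `0` (dominated convergence along the paths). -/
theorem pinnedChain_tendsto_integral_cutoff_kernel_temps (s : ℝ≥0) (x : PhaseSpace N) {K : ℝ} (hK : 0 < K) :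
    Tendsto (fun δ : ℝ => ∫ y, smoothCutoff ((pinnedChain ω₂ lam β γ).hamiltonian N y / K) * φ y
        ∂((pinnedChain ω₂ lam β γ).transitionKernel N (T + δ / 2) (T - δ / 2) s x)) (𝓝 0)
      (𝓝 (∫ y, smoothCutoff ((pinnedChain ω₂ lam β γ).hamiltonian N y / K) * φ y
        ∂((pinnedChain ω₂ lam β γ).transitionKernel N T T s x))) := by
  have hgc : Continuous fun y : PhaseSpace N =>
      smoothCutoff ((pinnedChain ω₂ lam β γ).hamiltonian N y / K) * φ y :=
    ((contDiff_smoothCutoff (n := 0)).continuous.comp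
      ((pinnedChain_contDiff_hamiltonian ω₂ lam β γ N (n := 0)).continuous.div_const K)).mul hφc
  have hgs : HasCompactSupport fun y : PhaseSpace N =>
      smoothCutoff ((pinnedChain ω₂ lam β γ).hamiltonian N y / K) * φ y := by
    refine HasCompactSupport.intro (pinnedChain_isCompact_setOf_hamiltonian_le hω hl hβ γ N (2 * K))
      fun y hy => ?_
    simp only [Set.mem_setOf_eq, not_le] at hy
    rw [smoothCutoff_of_two_le ((le_div_iff₀ hK).2 hy.le), zero_mul]
  obtain ⟨B, hB⟩ := hgc.bounded_above_of_compact_support hgs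
  -- through the solution map
  have heq : ∀ T_L T_R : ℝ, ∫ y, smoothCutoff ((pinnedChain ω₂ lam β γ).hamiltonian N y / K) * φ y
      ∂((pinnedChain ω₂ lam β γ).transitionKernel N T_L T_R s x) =
      ∫ ω, (fun y => smoothCutoff ((pinnedChain ω₂ lam β γ).hamiltonian N y / K) * φ y)
        ((pinnedChain ω₂ lam β γ).solMap N T_L T_R s x (pairPath ω)) ∂wienerPair := fun T_L T_R =>
    pinnedChain_integral_transitionKernel hω hl hβ hγ.le N T_L T_R s x hgc.aestronglyMeasurable
  simp_rw [heq]
  refine tendsto_integral_filter_of_dominated_convergence (fun _ => B)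
    (Eventually.of_forall fun δ => (hgc.measurable.comp
      (pinnedChain_measurable_solMap_pairPath_right hω hl hβ hγ.le N _ _ s x)).aestronglyMeasurable)
    (Eventually.of_forall fun δ => Eventually.of_forall fun ω => hB _) (integrable_const B)
    (Eventually.of_forall fun ω => ?_)
  exact (hgc.tendsto _).comp (pinnedChain_tendsto_solMap_temps hω hl hβ hγ.le N hT s x (pairPath ω))

/-- **The forecasts are continuous in the bath temperatures** (hypothesis `hCONT` of the conditional
reduction, PROVED): for continuous `φ` with `|φ| ≤ C e^{ϑH}` (`0 < ϑ`, `2ϑ < 1/T`), `s ≥ 0` and `x`,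
`δ ↦ P^{(T+δ/2,T-δ/2)}_s φ(x)` is continuous at `δ = 0`. -/
theorem pinnedChain_tendsto_integral_kernel_temps (s : ℝ≥0) (x : PhaseSpace N) :
    Tendsto (fun δ : ℝ => ∫ y, φ y ∂((pinnedChain ω₂ lam β γ).transitionKernel N (T + δ / 2)
        (T - δ / 2) s x)) (𝓝 0)
      (𝓝 (∫ y, φ y ∂((pinnedChain ω₂ lam β γ).transitionKernel N T T s x))) := by
  have hHc : Continuous ((pinnedChain ω₂ lam β γ).hamiltonian N) :=
    (pinnedChain_contDiff_hamiltonian ω₂ lam β γ N (n := 0)).continuous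
  have hsc : Continuous smoothCutoff := (contDiff_smoothCutoff (n := 0)).continuous
  have hC : 0 ≤ C := by
    have := (abs_nonneg _).trans (hφ 0)
    exact nonneg_of_mul_nonneg_left this (Real.exp_pos _)
  -- a `δ`-range on which `2ϑ < 1/max(T ± δ/2)`
  have h2ϑ0 : 0 < 2 * ϑ := by positivity
  set δ₁ : ℝ := min (1 / (2 * ϑ) - T) T with hδ₁
  have hδ₁0 : 0 < δ₁ := by
    refine lt_min ?_ hT
    have : T < 1 / (2 * ϑ) := by
      rw [lt_div_iff₀ h2ϑ0]; rw [lt_div_iff₀ hT] at h2ϑ; linarith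
    linarith
  have hfacts : ∀ δ : ℝ, |δ| < δ₁ → 0 < T + δ / 2 ∧ 0 < T - δ / 2 ∧
      2 * ϑ < 1 / max (T + δ / 2) (T - δ / 2) := by
    intro δ hδ
    have h1 := abs_lt.1 hδ
    have hδT : δ₁ ≤ T := min_le_right _ _
    have hδ2 : δ₁ ≤ 1 / (2 * ϑ) - T := min_le_left _ _
    have hL : 0 < T + δ / 2 := by linarith
    have hR : 0 < T - δ / 2 := by linarith
    refine ⟨hL, hR, ?_⟩
    have hmax : max (T + δ / 2) (T - δ / 2) < 1 / (2 * ϑ) := max_lt (by linarith) (by linarith)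
    rw [lt_div_iff₀ (lt_max_of_lt_left hL)]
    rw [lt_div_iff₀ h2ϑ0] at hmax
    linarith
  -- the truncation error, uniformly in `|δ| < δ₁`
  have htail : ∀ (Kc : ℝ), 0 < Kc → ∀ δ : ℝ, |δ| < δ₁ →
      |(∫ y, φ y ∂((pinnedChain ω₂ lam β γ).transitionKernel N (T + δ / 2) (T - δ / 2) s x)) -
        ∫ y, smoothCutoff ((pinnedChain ω₂ lam β γ).hamiltonian N y / Kc) * φ y
          ∂((pinnedChain ω₂ lam β γ).transitionKernel N (T + δ / 2) (T - δ / 2) s x)| ≤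
        C * Real.exp (-ϑ * Kc) * (Real.exp (2 * ϑ * γ * (2 * T) * s) *
          Real.exp (2 * ϑ * (pinnedChain ω₂ lam β γ).hamiltonian N x)) := by
    intro Kc hKc δ hδ
    obtain ⟨hL, hR, hϑ'⟩ := hfacts δ hδ
    have hIφ := pinnedChain_integrable_kernel_of_abs_le hω hl hβ hγ hN hL hR hϑ
      (lt_of_le_of_lt (by linarith) hϑ') hφc hφ s x
    have hgc : Continuous fun y : PhaseSpace N =>
        smoothCutoff ((pinnedChain ω₂ lam β γ).hamiltonian N y / Kc) * φ y :=
      (hsc.comp (hHc.div_const Kc)).mul hφc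
    have hIg : Integrable (fun y => smoothCutoff ((pinnedChain ω₂ lam β γ).hamiltonian N y / Kc) * φ y)
        ((pinnedChain ω₂ lam β γ).transitionKernel N (T + δ / 2) (T - δ / 2) s x) :=
      hIφ.mono hgc.aestronglyMeasurable (Eventually.of_forall fun y => by
        rw [Real.norm_eq_abs, Real.norm_eq_abs, abs_mul, abs_of_nonneg (smoothCutoff_nonneg _)]
        exact mul_le_of_le_one_left (abs_nonneg _) (smoothCutoff_le_one _))
    have hI2 := pinnedChain_integrable_exp_kernel hω hl hβ hγ hN hL hR h2ϑ0 hϑ' s x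
    rw [← integral_sub hIφ hIg]
    -- pointwise: `|φ - χ(H/K)φ| ≤ C e^{-ϑK} e^{2ϑH}`
    have hpt : ∀ y : PhaseSpace N, |φ y - smoothCutoff ((pinnedChain ω₂ lam β γ).hamiltonian N y / Kc) * φ y| ≤
        C * Real.exp (-ϑ * Kc) * Real.exp (2 * ϑ * (pinnedChain ω₂ lam β γ).hamiltonian N y) := by
      intro y
      set Hy := (pinnedChain ω₂ lam β γ).hamiltonian N y
      rcases le_or_gt Hy Kc with hle | hlt
      · rw [smoothCutoff_of_le_one ((div_le_one hKc).2 hle), one_mul, sub_self, abs_zero]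
        positivity
      · have h1 : |φ y - smoothCutoff (Hy / Kc) * φ y| ≤ |φ y| := by
          rw [show φ y - smoothCutoff (Hy / Kc) * φ y = (1 - smoothCutoff (Hy / Kc)) * φ y by ring,
            abs_mul, abs_of_nonneg (by linarith [smoothCutoff_le_one (Hy / Kc)])]
          exact mul_le_of_le_one_left (abs_nonneg _) (by linarith [smoothCutoff_nonneg (Hy / Kc)])
        have h2 : Real.exp (ϑ * Hy) ≤ Real.exp (-ϑ * Kc) * Real.exp (2 * ϑ * Hy) := by
          rw [← Real.exp_add]
          exact Real.exp_le_exp.2 (by nlinarith)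
        calc _ ≤ |φ y| := h1
          _ ≤ C * Real.exp (ϑ * Hy) := hφ y
          _ ≤ C * (Real.exp (-ϑ * Kc) * Real.exp (2 * ϑ * Hy)) := mul_le_mul_of_nonneg_left h2 hC
          _ = _ := by ring
    have hb := pinnedChain_integral_exp_kernel_le hω hl hβ hγ hN hL hR h2ϑ0 hϑ' s x
    rw [show T + δ / 2 + (T - δ / 2) = 2 * T by ring] at hb
    calc _ ≤ ∫ y, C * Real.exp (-ϑ * Kc) * Real.exp (2 * ϑ * (pinnedChain ω₂ lam β γ).hamiltonian N y)
          ∂((pinnedChain ω₂ lam β γ).transitionKernel N (T + δ / 2) (T - δ / 2) s x) := by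
          rw [← Real.norm_eq_abs]
          exact norm_integral_le_of_norm_le (hI2.const_mul _) (Eventually.of_forall fun y => by
            rw [Real.norm_eq_abs]; exact hpt y)
      _ = C * Real.exp (-ϑ * Kc) * ∫ y, Real.exp (2 * ϑ * (pinnedChain ω₂ lam β γ).hamiltonian N y)
          ∂((pinnedChain ω₂ lam β γ).transitionKernel N (T + δ / 2) (T - δ / 2) s x) := integral_const_mul _ _
      _ ≤ _ := mul_le_mul_of_nonneg_left hb (by positivity)
  -- `3ε`
  rw [Metric.tendsto_nhds]
  intro ε hε
  set W : ℝ := Real.exp (2 * ϑ * γ * (2 * T) * s) * Real.exp (2 * ϑ * (pinnedChain ω₂ lam β γ).hamiltonian N x)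
    with hW
  have hW0 : 0 < W := by positivity
  -- choose the truncation level
  obtain ⟨Kc, hKc0, hKc⟩ : ∃ Kc : ℝ, 0 < Kc ∧ C * Real.exp (-ϑ * Kc) * W < ε / 3 := by
    have h1 : Tendsto (fun Kc : ℝ => -ϑ * Kc) atTop atBot :=
      tendsto_id.const_mul_atTop_of_neg (by linarith : -ϑ < 0)
    have h2 : Tendsto (fun Kc : ℝ => Real.exp (-ϑ * Kc)) atTop (𝓝 0) := Real.tendsto_exp_atBot.comp h1
    have h : Tendsto (fun Kc : ℝ => C * Real.exp (-ϑ * Kc) * W) atTop (𝓝 (C * 0 * W)) :=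
      (h2.const_mul C).mul_const W
    rw [mul_zero, zero_mul] at h
    obtain ⟨Kc, hKc⟩ := ((h.eventually (Iio_mem_nhds (by positivity : (0:ℝ) < ε / 3))).and
      (eventually_gt_atTop 0)).exists
    exact ⟨Kc, hKc.2, hKc.1⟩
  have hmid := pinnedChain_tendsto_integral_cutoff_kernel_temps hω hl hβ hγ hT hφc s x hKc0
  rw [Metric.tendsto_nhds] at hmid
  have hball : ∀ᶠ δ in 𝓝 (0 : ℝ), |δ| < δ₁ := by
    have : Metric.ball (0 : ℝ) δ₁ ∈ 𝓝 (0 : ℝ) := Metric.ball_mem_nhds 0 hδ₁0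
    filter_upwards [this] with δ hδ
    simpa [Real.dist_eq] using hδ
  filter_upwards [hmid (ε / 3) (by positivity), hball] with δ hδm hδ1
  have h1 := htail Kc hKc0 δ hδ1
  have h0 := htail Kc hKc0 0 (by simpa using hδ₁0)
  simp only [zero_div, add_zero, sub_zero] at h0
  rw [Real.dist_eq] at hδm ⊢
  -- triangle inequality
  have key : ∀ (a b c d : ℝ), |a - b| ≤ ε / 3 → |b - c| < ε / 3 → |d - c| ≤ ε / 3 → |a - d| < ε := by
    intro a b c d h1 h2 h3
    have := abs_sub_le a b d
    have := abs_sub_le b c d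
    rw [abs_sub_comm d c] at h3
    linarith
  exact key _ _ _ _ (h1.trans hKc.le) hδm (h0.trans hKc.le)

end Expectation

end Summit.AtomisticToContinuum.FouriersLaw.Theorems

end
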